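import Summits.AtomisticToContinuum.HydrodynamicLimit.Theorems.JParityClosureEvenStressEnskogEnskogIdentificationFields
import Summits.AtomisticToContinuum.HydrodynamicLimit.Theorems.JParityClosureEvenStressEnskogEnskogPointwise
import Summits.AtomisticToContinuum.HydrodynamicLimit.Theorems.JParityClosureKineticEnergyTailsApriori
import HarnessLib

/-!
# One-body deviation at rung 0 (stub S3b2 `stub_oneBodyDeviationRung0` of the line
# `preshock-kinetic-slaving`, crux `JParityClosure.EvenStressEnskog`, stmt-AtomisticToContinuum-13079)
# — helper file 1: the deterministic envelope of the window deviation

For one configuration `w` of `N + 1` particles, the cone scale `r > 0`, a centre `x` and a test function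
`F(v, u, θ)` of quadratic growth `|F(v, u, θ)| ≤ C (1 + ‖v‖² + ‖u‖² + |θ|)`, the window statistic
`S(w) = ∫ b_r(y, x) F(v, u_r, θ_r) dμ_w(y, v)` and its local-Maxwellian prediction
`ρ_r H(u_r, θ_r)`, `H(u', θ') = ∫ F(v, u', θ') M_{1,θ',u'}(v) dv`, obey the deterministic envelope

  `|S(w) − ρ_r H(u_r, θ_r)| ≤ 2C (ρ_r + 6 e_r) ≤ 2C (3/(πr³)) (1 + 3 (N+1)⁻¹ Σᵢ ‖vᵢ‖²)`

(`abs_windowDeviation_le`, `abs_windowDeviation_le_velAvg`).  Ingredients: `θ_r ≥ 0` and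
`ρ_r ‖u_r‖² ≤ 2 e_r` (Cauchy–Schwarz, `mollTemperature_nonneg`, `mollDensity_mul_norm_uC_sq_le`),
`ρ_r θ_r ≤ (2/3) e_r`, the Gaussian second moment `∫ ‖v‖² dN(u', θ' id) = ‖u'‖² + 3θ'`
(`integral_norm_sq_gaussMeasure`; `abs_maxwellPairing_le`: `|H(u', θ')| ≤ C (1 + 2‖u'‖² + 4θ')` for
`θ' > 0`, and `H = 0` on the junk branch `θ' ≤ 0` where `M ≡ 0`, `localMaxwellian_eq_zero_of_nonpos`).

References: H. Spohn, *Large Scale Dynamics of Interacting Particles* (1991), Part I §2.3.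
-/

noncomputable section

open MeasureTheory ProbabilityTheory Filter Set Topology
open scoped ENNReal InnerProductSpace BigOperators

namespace Summit.AtomisticToContinuum.HydrodynamicLimit.Theorems.EvenStressEnskog

open Literature.Analysis.FluidPDE Literature.MathematicalPhysics.KineticTheory

variable {N : ℕ}

/-! ## Sign facts of the window fields -/

/-- The growth constant of a quadratic-growth test function is nonnegative. [folklore] -/
theorem quadGrowthConst_nonneg {F : V3 × V3 × ℝ → ℝ} {C : ℝ}
    (hC : ∀ q, |F q| ≤ C * (1 + ‖q.1‖ ^ 2 + ‖q.2.1‖ ^ 2 + |q.2.2|)) : 0 ≤ C := by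
  have h := hC ((0 : V3), (0 : V3), (0 : ℝ))
  simp only [norm_zero, abs_zero] at h
  have : (0 : ℝ) ≤ C * (1 + 0 ^ 2 + 0 ^ 2 + 0) := (abs_nonneg _).trans h
  linarith

/-- **`ρ_r ‖u_r‖² ≤ 2 e_r`** (Cauchy–Schwarz: the peculiar second moment about `u_r` is
`2e_r − ρ_r‖u_r‖² ≥ 0`; junk branch `ρ_r = 0` included). [folklore] -/
theorem mollDensity_mul_norm_uC_sq_le {r : ℝ} (hr : 0 < r) (z : Config (N + 1) (Fin 3) T3) (x : T3) :
    mollDensity r z x * ‖KineticEntropyBalance.uC r z x‖ ^ 2 ≤ 2 * mollKineticEnergy r z x := by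
  have h0 : 0 ≤ ((N + 1 : ℕ) : ℝ)⁻¹ *
      ∑ i, coneKernel r (z i).1 x * ‖(z i).2 - KineticEntropyBalance.uC r z x‖ ^ 2 :=
    mul_nonneg (inv_nonneg.2 (Nat.cast_nonneg _))
      (Finset.sum_nonneg fun i _ => mul_nonneg (coneKernel_mem_Icc hr _ _).1 (sq_nonneg _))
  rw [avg_coneKernel_mul_norm_sub_sq_eq] at h0
  have hρ0 : 0 ≤ mollDensity r z x := mollDensity_nonneg_of_pos hr z x
  have he0 : 0 ≤ mollKineticEnergy r z x := mollKineticEnergy_nonneg hr z x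
  unfold KineticEntropyBalance.uC at h0 ⊢
  rw [real_inner_smul_right, real_inner_self_eq_norm_sq, norm_smul, Real.norm_eq_abs, abs_inv,
    abs_of_nonneg hρ0] at h0
  rw [norm_smul, Real.norm_eq_abs, abs_inv, abs_of_nonneg hρ0]
  rcases hρ0.eq_or_lt with h | hpos
  · rw [← h, zero_mul]
    positivity
  · have hid : mollDensity r z x * ((mollDensity r z x)⁻¹ * ‖mollMomentum r z x‖) ^ 2 =
        (mollDensity r z x)⁻¹ * ‖mollMomentum r z x‖ ^ 2 := by
      field_simp
    rw [hid] at h0 ⊢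
    linarith

/-- **`θ_r ≥ 0`** (Cauchy–Schwarz; `θ_r = 0` on the junk branch `ρ_r = 0`). [folklore] -/
theorem mollTemperature_nonneg {r : ℝ} (hr : 0 < r) (z : Config (N + 1) (Fin 3) T3) (x : T3) :
    0 ≤ mollTemperature r z x := by
  have hρ0 : 0 ≤ mollDensity r z x := mollDensity_nonneg_of_pos hr z x
  have h1 := mollDensity_mul_norm_uC_sq_le hr z x
  unfold KineticEntropyBalance.uC at h1
  unfold mollTemperature
  rcases hρ0.eq_or_lt with h | hpos
  · rw [← h]
    simp
  · rw [norm_smul, Real.norm_eq_abs, abs_inv, abs_of_pos hpos] at h1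
    have hid : mollDensity r z x * ((mollDensity r z x)⁻¹ * ‖mollMomentum r z x‖) ^ 2 =
        (mollDensity r z x)⁻¹ * ‖mollMomentum r z x‖ ^ 2 := by
      field_simp
    rw [hid] at h1
    have hkey : 0 ≤ 2 * mollKineticEnergy r z x - (mollDensity r z x)⁻¹ * ‖mollMomentum r z x‖ ^ 2 := by
      linarith
    have hid2 : mollKineticEnergy r z x / mollDensity r z x -
        ‖mollMomentum r z x‖ ^ 2 / (2 * mollDensity r z x ^ 2) =
        (mollDensity r z x)⁻¹ *
          (2 * mollKineticEnergy r z x - (mollDensity r z x)⁻¹ * ‖mollMomentum r z x‖ ^ 2) / 2 := by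
      field_simp
    rw [hid2]
    positivity

/-- `ρ_r ≤ 3/(πr³)` (`0 < r`): an average of cone kernels. [folklore] -/
theorem mollDensity_le_coneBound {r : ℝ} (hr : 0 < r) (z : Config (N + 1) (Fin 3) T3) (x : T3) :
    mollDensity r z x ≤ 3 / (Real.pi * r ^ 3) := by
  rw [mollDensity_eq_avg]
  exact (empDensity_mem_Icc hr (fun i => (z i).1) x).2

/-- `e_r ≤ (3/(πr³)) · ((N+1)⁻¹ Σᵢ ‖vᵢ‖²) / 2`. [folklore] -/
theorem mollKineticEnergy_le_velAvg {r : ℝ} (hr : 0 < r) (z : Config (N + 1) (Fin 3) T3) (x : T3) :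
    mollKineticEnergy r z x ≤
      3 / (Real.pi * r ^ 3) * ((((N + 1 : ℕ) : ℝ)⁻¹ * ∑ i, ‖(z i).2‖ ^ 2) / 2) := by
  have h := mollKineticEnergy_le hr z x
  have hE : configEnergy z / ((N + 1 : ℕ) : ℝ) = (((N + 1 : ℕ) : ℝ)⁻¹ * ∑ i, ‖(z i).2‖ ^ 2) / 2 := by
    unfold configEnergy
    ring
  rwa [hE] at h

/-! ## The window statistic -/

/-- **Envelope of the window statistic**:
`|∫ b_r F(v, u_r, θ_r) dμ_w| ≤ C (ρ_r + 2e_r + ρ_r (‖u_r‖² + θ_r)) ≤ C (ρ_r + 5 e_r)`. [folklore] -/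
theorem abs_windowStat_le {r : ℝ} (hr : 0 < r) {F : V3 × V3 × ℝ → ℝ} {C : ℝ}
    (hC : ∀ q, |F q| ≤ C * (1 + ‖q.1‖ ^ 2 + ‖q.2.1‖ ^ 2 + |q.2.2|))
    (w : Config (N + 1) (Fin 3) T3) (x : T3) :
    |∫ q, coneKernel r q.1 x *
        F (q.2, KineticEntropyBalance.uC r w x, mollTemperature r w x) ∂(empiricalMeasure w)| ≤
      C * (mollDensity r w x + 5 * mollKineticEnergy r w x) := by
  have hC0 : 0 ≤ C := quadGrowthConst_nonneg hC
  have hθ0 := mollTemperature_nonneg hr w x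
  have he0 := mollKineticEnergy_nonneg hr w x
  have hρu := mollDensity_mul_norm_uC_sq_le hr w x
  have hρθ := mollDensity_mul_mollTemperature_le hr w x
  have hn : 0 ≤ ((N + 1 : ℕ) : ℝ)⁻¹ := inv_nonneg.2 (Nat.cast_nonneg _)
  -- the pointwise bound of the summands
  have hterm : ∀ i : Fin (N + 1),
      |coneKernel r (w i).1 x *
          F ((w i).2, KineticEntropyBalance.uC r w x, mollTemperature r w x)| ≤
        coneKernel r (w i).1 x * (C * (1 + ‖(w i).2‖ ^ 2 +
          ‖KineticEntropyBalance.uC r w x‖ ^ 2 + mollTemperature r w x)) := fun i => by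
    have hb := (coneKernel_mem_Icc hr (w i).1 x).1
    rw [abs_mul, abs_of_nonneg hb]
    refine mul_le_mul_of_nonneg_left ?_ hb
    have h := hC ((w i).2, KineticEntropyBalance.uC r w x, mollTemperature r w x)
    rwa [abs_of_nonneg hθ0] at h
  -- the finite-sum identity
  have hsum : ((N + 1 : ℕ) : ℝ)⁻¹ * ∑ i, coneKernel r (w i).1 x * (C * (1 + ‖(w i).2‖ ^ 2 +
      ‖KineticEntropyBalance.uC r w x‖ ^ 2 + mollTemperature r w x)) =
      C * (mollDensity r w x + 2 * mollKineticEnergy r w x + mollDensity r w x *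
        (‖KineticEntropyBalance.uC r w x‖ ^ 2 + mollTemperature r w x)) := by
    rw [mollDensity_eq_avg, mollKineticEnergy_eq_sum]
    have hi : ∀ i ∈ (Finset.univ : Finset (Fin (N + 1))),
        coneKernel r (w i).1 x * (C * (1 + ‖(w i).2‖ ^ 2 +
          ‖KineticEntropyBalance.uC r w x‖ ^ 2 + mollTemperature r w x)) =
        C * coneKernel r (w i).1 x + 2 * C * (coneKernel r (w i).1 x * (‖(w i).2‖ ^ 2 / 2)) +
          C * (‖KineticEntropyBalance.uC r w x‖ ^ 2 + mollTemperature r w x) *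
            coneKernel r (w i).1 x := fun i _ => by ring
    rw [Finset.sum_congr rfl hi, Finset.sum_add_distrib, Finset.sum_add_distrib, ← Finset.mul_sum,
      ← Finset.mul_sum, ← Finset.mul_sum]
    ring
  rw [integral_empiricalMeasure, abs_mul, abs_of_nonneg hn]
  calc ((N + 1 : ℕ) : ℝ)⁻¹ * |∑ i, coneKernel r (w i).1 x *
          F ((w i).2, KineticEntropyBalance.uC r w x, mollTemperature r w x)|
      ≤ ((N + 1 : ℕ) : ℝ)⁻¹ * ∑ i, coneKernel r (w i).1 x * (C * (1 + ‖(w i).2‖ ^ 2 +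
          ‖KineticEntropyBalance.uC r w x‖ ^ 2 + mollTemperature r w x)) :=
        mul_le_mul_of_nonneg_left ((Finset.abs_sum_le_sum_abs _ _).trans
          (Finset.sum_le_sum fun i _ => hterm i)) hn
    _ = C * (mollDensity r w x + 2 * mollKineticEnergy r w x + mollDensity r w x *
          (‖KineticEntropyBalance.uC r w x‖ ^ 2 + mollTemperature r w x)) := hsum
    _ = C * (mollDensity r w x + 2 * mollKineticEnergy r w x +
          (mollDensity r w x * ‖KineticEntropyBalance.uC r w x‖ ^ 2 +
            mollDensity r w x * mollTemperature r w x)) := by ring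
    _ ≤ C * (mollDensity r w x + 2 * mollKineticEnergy r w x +
          (2 * mollKineticEnergy r w x + 2 / 3 * mollKineticEnergy r w x)) := by
        gcongr
    _ ≤ C * (mollDensity r w x + 5 * mollKineticEnergy r w x) := by
        refine mul_le_mul_of_nonneg_left ?_ hC0
        linarith

/-! ## The local-Maxwellian pairing -/

/-- **Envelope of the local-Maxwellian pairing** (`θ > 0`):
`|∫ F(v, u, θ) M_{1,θ,u}(v) dv| ≤ C (1 + 2‖u‖² + 4θ)` (Gaussian second moment). [folklore] -/
theorem abs_maxwellPairing_le {F : V3 × V3 × ℝ → ℝ} {C : ℝ}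
    (hC : ∀ q, |F q| ≤ C * (1 + ‖q.1‖ ^ 2 + ‖q.2.1‖ ^ 2 + |q.2.2|)) (u : V3) {θ : ℝ} (hθ : 0 < θ) :
    |∫ v, F (v, u, θ) * localMaxwellian 1 θ u v| ≤ C * (1 + 2 * ‖u‖ ^ 2 + 4 * θ) := by
  have heq : ∫ v, F (v, u, θ) * localMaxwellian 1 θ u v = ∫ v, F (v, u, θ) ∂gaussMeasure u θ := by
    rw [← integral_localMaxwellian_mul_eq_integral_gaussMeasure hθ u]
    exact integral_congr_ae (ae_of_all _ fun v => mul_comm _ _)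
  rw [heq]
  have hsq : Integrable (fun v : V3 => ‖v‖ ^ 2) (gaussMeasure u θ) :=
    (IsGaussian.memLp_id _ 2 (by simp)).integrable_norm_pow (by norm_num)
  have hfun : (fun v : V3 => C * (1 + ‖v‖ ^ 2 + ‖u‖ ^ 2 + |θ|)) =
      fun v => C * (1 + ‖u‖ ^ 2 + |θ|) + C * ‖v‖ ^ 2 := by
    funext v
    ring
  have hg : Integrable (fun v : V3 => C * (1 + ‖v‖ ^ 2 + ‖u‖ ^ 2 + |θ|)) (gaussMeasure u θ) := by
    rw [hfun]
    exact (integrable_const _).add (hsq.const_mul C)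
  have h := norm_integral_le_of_norm_le hg
    (ae_of_all _ fun v => by rw [Real.norm_eq_abs]; exact hC (v, u, θ))
  rw [Real.norm_eq_abs] at h
  refine h.trans (le_of_eq ?_)
  rw [hfun, integral_add (integrable_const _) (hsq.const_mul C), integral_const, integral_const_mul,
    integral_norm_sq_gaussMeasure u hθ, smul_eq_mul, probReal_univ, abs_of_pos hθ]
  ring

/-- **Envelope of the weighted prediction**: `ρ_r |H(u_r, θ_r)| ≤ C (ρ_r + 7 e_r)` (for `θ_r > 0` by
`abs_maxwellPairing_le`, `ρ_r‖u_r‖² ≤ 2e_r`, `ρ_rθ_r ≤ (2/3)e_r`; for `θ_r = 0` the Maxwellian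
vanishes). [folklore] -/
theorem mollDensity_mul_abs_maxwellPairing_le {r : ℝ} (hr : 0 < r) {F : V3 × V3 × ℝ → ℝ} {C : ℝ}
    (hC : ∀ q, |F q| ≤ C * (1 + ‖q.1‖ ^ 2 + ‖q.2.1‖ ^ 2 + |q.2.2|))
    (w : Config (N + 1) (Fin 3) T3) (x : T3) :
    mollDensity r w x *
        |∫ v, F (v, KineticEntropyBalance.uC r w x, mollTemperature r w x) *
          localMaxwellian 1 (mollTemperature r w x) (KineticEntropyBalance.uC r w x) v| ≤
      C * (mollDensity r w x + 7 * mollKineticEnergy r w x) := by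
  have hC0 : 0 ≤ C := quadGrowthConst_nonneg hC
  have hρ0 : 0 ≤ mollDensity r w x := mollDensity_nonneg_of_pos hr w x
  have he0 := mollKineticEnergy_nonneg hr w x
  have hθ0 := mollTemperature_nonneg hr w x
  have hρu := mollDensity_mul_norm_uC_sq_le hr w x
  have hρθ := mollDensity_mul_mollTemperature_le hr w x
  rcases hθ0.eq_or_lt with hz | hpos
  · have h0 : ∫ v, F (v, KineticEntropyBalance.uC r w x, mollTemperature r w x) *
        localMaxwellian 1 (mollTemperature r w x) (KineticEntropyBalance.uC r w x) v = 0 := by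
      simp [localMaxwellian_eq_zero_of_nonpos (le_of_eq hz.symm)]
    rw [h0, abs_zero, mul_zero]
    positivity
  · calc mollDensity r w x *
          |∫ v, F (v, KineticEntropyBalance.uC r w x, mollTemperature r w x) *
            localMaxwellian 1 (mollTemperature r w x) (KineticEntropyBalance.uC r w x) v|
        ≤ mollDensity r w x * (C * (1 + 2 * ‖KineticEntropyBalance.uC r w x‖ ^ 2 +
            4 * mollTemperature r w x)) :=
          mul_le_mul_of_nonneg_left (abs_maxwellPairing_le hC _ hpos) hρ0
      _ = C * (mollDensity r w x + 2 * (mollDensity r w x * ‖KineticEntropyBalance.uC r w x‖ ^ 2) +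
            4 * (mollDensity r w x * mollTemperature r w x)) := by ring
      _ ≤ C * (mollDensity r w x + 2 * (2 * mollKineticEnergy r w x) +
            4 * (2 / 3 * mollKineticEnergy r w x)) := by gcongr
      _ ≤ C * (mollDensity r w x + 7 * mollKineticEnergy r w x) := by
          refine mul_le_mul_of_nonneg_left ?_ hC0
          linarith

/-! ## The envelope of the deviation -/

/-- **Deterministic envelope of the window deviation**:
`|S(w) − ρ_r H(u_r, θ_r)| ≤ 2C (ρ_r + 6 e_r)`. [folklore] -/
theorem abs_windowDeviation_le {r : ℝ} (hr : 0 < r) {F : V3 × V3 × ℝ → ℝ} {C : ℝ}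
    (hC : ∀ q, |F q| ≤ C * (1 + ‖q.1‖ ^ 2 + ‖q.2.1‖ ^ 2 + |q.2.2|))
    (w : Config (N + 1) (Fin 3) T3) (x : T3) :
    |(∫ q, coneKernel r q.1 x *
          F (q.2, KineticEntropyBalance.uC r w x, mollTemperature r w x) ∂(empiricalMeasure w)) -
        mollDensity r w x *
          ∫ v, F (v, KineticEntropyBalance.uC r w x, mollTemperature r w x) *
            localMaxwellian 1 (mollTemperature r w x) (KineticEntropyBalance.uC r w x) v| ≤
      2 * C * (mollDensity r w x + 6 * mollKineticEnergy r w x) := by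
  have h1 := abs_windowStat_le hr hC w x
  have h2 := mollDensity_mul_abs_maxwellPairing_le hr hC w x
  have hρ0 : 0 ≤ mollDensity r w x := mollDensity_nonneg_of_pos hr w x
  refine (abs_sub _ _).trans ?_
  rw [abs_mul, abs_of_nonneg hρ0]
  linarith

/-- **Deterministic envelope in terms of the velocity average**:
`|S(w) − ρ_r H(u_r, θ_r)| ≤ 2C (3/(πr³)) (1 + 3 (N+1)⁻¹ Σᵢ ‖vᵢ‖²)`. [folklore] -/
theorem abs_windowDeviation_le_velAvg :
    ∀ {N : ℕ} {r : ℝ}, 0 < r → ∀ {F : V3 × V3 × ℝ → ℝ} {C : ℝ},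
    (∀ q, |F q| ≤ C * (1 + ‖q.1‖ ^ 2 + ‖q.2.1‖ ^ 2 + |q.2.2|)) →
    ∀ (w : Config (N + 1) (Fin 3) T3) (x : T3),
    |(∫ q, coneKernel r q.1 x *
          F (q.2, KineticEntropyBalance.uC r w x, mollTemperature r w x) ∂(empiricalMeasure w)) -
        mollDensity r w x *
          ∫ v, F (v, KineticEntropyBalance.uC r w x, mollTemperature r w x) *
            localMaxwellian 1 (mollTemperature r w x) (KineticEntropyBalance.uC r w x) v| ≤
      2 * C * (3 / (Real.pi * r ^ 3)) +
        6 * C * (3 / (Real.pi * r ^ 3)) * (((N + 1 : ℕ) : ℝ)⁻¹ * ∑ i, ‖(w i).2‖ ^ 2) := by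
  intro N r hr F C hC w x
  have hC0 : 0 ≤ C := quadGrowthConst_nonneg hC
  have h := abs_windowDeviation_le hr hC w x
  have hρ := mollDensity_le_coneBound hr w x
  have he := mollKineticEnergy_le_velAvg hr w x
  have hB : 0 ≤ 3 / (Real.pi * r ^ 3) := by positivity
  refine h.trans ?_
  have h6 : 6 * mollKineticEnergy r w x ≤
      3 * (3 / (Real.pi * r ^ 3)) * (((N + 1 : ℕ) : ℝ)⁻¹ * ∑ i, ‖(w i).2‖ ^ 2) := by linarith
  nlinarith [mul_le_mul_of_nonneg_left (add_le_add hρ h6) (by positivity : (0 : ℝ) ≤ 2 * C)]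

end Summit.AtomisticToContinuum.HydrodynamicLimit.Theorems.EvenStressEnskog

end
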